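import Summits.ABC.IUTFork.Thm311Real2
import Summits.ABC.IUTFork.Thm311LogKummer
import Literature.IUT.LogVolume.PilotDivisors
import HarnessLib

/-!
# [IUTchIII] Theorem 3.11 over real definitions, C: the columns (ii) and "the situation of Theorem 3.11" with its lattice INSTANTIATED

Record-only file (D-0012) of the abc-iut cell (Cor. 3.12 sub-crew, wave-2 seat abc-iut-c312-5, board row
W2-A); TAKES NO SIDE on [IUTchIII] Cor. 3.12. Sequel to `Thm311Real2` (`MRData.ofShells`,
`GlobalDegrees.ofDivisors`, `Situation.ofShells` for ANY log-shell signature; `Real.situation` the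
Dupuy–Hilado-level specialisation). abc-iut-c312-1's `Thm311LogKummer.lean` (file C) types [IUTchIII] Thm. 3.11
(ii) + (Ind3) over the SIGNATURE `Column L` (the Frobenius-like data of the `n`-th column seen on the coric
packets through the Kummer isomorphisms) and `LatticeSituation T` (= `Situation` + one `Column` per `n`). This
file builds both GENERICALLY (§1–§2) and specialises to the real carriers (§3):

* `Column.ofDivisors L M …` — the global realified Frobenioids `C^⊩_LGP`, `C^⊩_lgp` (vertically coric and
  Frobenius-like copies) modelled at the Dupuy–Hilado level by abc-iut-c312-3's lgp-DIVISORS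
  `LgpDivisor M l⋇ = (Fin l⋇ → FinDivisor M)` (`PilotDivisors.lean` p404008, DH Def. 3.1.1) over a number field
  `M`, the Kummer isomorphisms of (ii) (c) by `Equiv.refl` (one carrier), the Θ-pilot object of `^{n,m}C^⊩_LGP`
  ([IUTchIII] Def. 3.8 (i)) by an lgp-divisor `thetaDiv m` (binder; at the DH level **c312-3's Θ-pilot divisor
  `X.thetaPilot = (j²·P_q)_j`**, DH §3.3); holomorphic volumes and the Kummer images of splitting monoids /
  number fields / unit groups / balls as BINDERS;
* `LatticeSituation.ofShells`; `Real.latticeSituation X …` the DH-level specialisation.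

## RESIDUAL LIST of this file (binder → owner · node)
* `frobAdm`, `frobLogvol` (holomorphic log-volumes of Prop. 3.9 (i) read through Kummer) → abc-iut-L6-t4 ·
  IUTchIII:Prop3.9(i)/(iv) + the completed-packet comparison (abc-iut-S1 · IUTchIV:Prop1.1–1.3);
* `frobΨ` → abc-iut-L6-t4 · IUTchIII:Prop3.4(ii)/3.5(ii)(c) + abc-iut-L6-t2 · IUTchII:Cor4.6(iii); `frobMmod` →
  abc-iut-L6-t4 · IUTchIII:Prop3.10(i);
* `unitImage`, `ballImage` (Prop. 3.5 (ii) (a)(b)) → abc-iut-L6-t4 + abc-iut-L6-t3 · IUTchIII:Def1.1 log-link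
  (`LogLink.lean`) + abc-iut-L6-t2 · IUTchII:Cor4.6 `Ψ_cns`;
* `thetaDiv` at the M level → abc-iut-L5-t2 · IUTchI:Ex3.5 (`GlobalRealifiedFrobenioids.lean`, staged: Θ-pilot
  divisor of the initial Θ-data); at the DH level it is c312-3's `PilotData.thetaPilot` (§3, no binder);
* `PilotNouns` (c312-1 file G) is NOT instantiated: its fields are the W2-B/W2-C objects (abc-iut-c312-7
  `Cor312Statement` — landed — and abc-iut-c312-6 `Cor312Containers`).

## Vacuity audit (neutral; for every `L`)
`Column.partII_iff_ind3_of_coric`: in the STRICTIFIED reading (Frobenius-like binders EQUAL to the coric data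
of the line; Kummer isomorphisms the identity) abc-iut-c312-1's typing of Thm. 3.11 (ii) is EQUIVALENT TO
(Ind3) ALONE — (ii) (a)(b)(c), the mutual compatibility and the final clause hold by `rfl` (sharpening c312-1's
`partII_iff`); so, at this level of modelling, the content of (ii) is (Ind3) plus whatever non-identity Kummer
transport campaign M supplies. `Real.kumLGP_thetaPilot`: at the DH level the Kummer image of the Θ-pilot
object is DH's Θ-pilot divisor, whose lgp-degree exceeds `deg P_q` (c312-3's `deg_qPilot_lt_degLgp_thetaPilot`).

Sources read on the page: [IUTchIII] pp. 153–156 (Thm. 3.11 (i)(ii), (Ind3)); Dupuy–Hilado §3.1–3.3.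
[claim: Mochizuki2012, status: disputed] [cite: DupuyHilado2025, §3.3]
NOT here: `LinkData` / `FullSituation` ((iii) tautological per c312-1); log-volume values; any judgement.
typed ≠ discharged; instantiated ≠ endorsed.
-/

noncomputable section

namespace Summit.ABC.IUTFork.Thm311

open NumberField IsDedekindDomain Literature.IUT.LogVolume Literature.IUT.LogThetaLattice

variable {T : ThetaIndex}

/-! ## 1. One column, from any log-shell signature -/

namespace Column

section OfDivisors

variable (L : LogShells T) (M : Type) [Field M] [NumberField M]
  (frobAdm : ℤ → ∀ (j : T.Label) (vQ : T.VQ), Set (L.Packet j vQ) → Prop)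
  (frobLogvol : ℤ → ∀ (j : T.Label) (vQ : T.VQ), Set (L.Packet j vQ) → ℝ)
  (frobΨ : ℤ → ∀ v : T.V, v ∈ T.Vbad → Set (L.StarPacket v))
  (frobMmod : ℤ → ∀ j : T.LabelStar, Set (L.GlobalPacket j.1))
  (unitImage : ℤ → ℕ → ∀ (j : T.Label) (vQ : T.VQ), Set (L.Packet j vQ))
  (ballImage : ℤ → ∀ (j : T.Label) (vQ : T.VQ), Set (L.Packet j vQ))
  (thetaDiv : ℤ → LgpDivisor M T.lstar)

/-- **`Thm311.Column` BUILT FROM LGP-DIVISORS** ([IUTchIII] Thm. 3.11 (ii), pp. 155–156: the Frobenius-like data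
of the `n`-th column read on the coric packets through the Kummer isomorphisms): `C^⊩_LGP(^{n,∘}HT)`,
`^{n,m}C^⊩_LGP` (and the `lgp` versions, Prop. 3.7 (iii)–(v)) modelled by abc-iut-c312-3's lgp-divisors
`LgpDivisor M l⋇` (Dupuy–Hilado Def. 3.1.1) over the number field `M`, the Kummer isomorphisms of (ii) (c) by
`Equiv.refl`, the Θ-pilot object of `^{n,m}C^⊩_LGP` (Def. 3.8 (i), p. 112 l. 47–49, quoted exactly: "determined by
any collection, indexed by `v ∈ V^bad`, of generators up to torsion of the monoids `Ψ^⊥_{F_lgp}(†HT^{Θ±ell}NF)_v`" —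
the SPLITTING monoids of Prop. 3.5 (ii)(c); ref-b PASS-B6 B6-5) by the lgp-divisor `thetaDiv m`; holomorphic
log-volumes and the
Kummer images of splitting monoids, number fields, unit groups and balls as BINDERS (module docstring).
[claim: Mochizuki2012, status: disputed] -/
def ofDivisors : Column L where
  frobAdm := frobAdm
  frobLogvol := frobLogvol
  frobΨ := frobΨ
  frobMmod := frobMmod
  unitImage := unitImage
  ballImage := ballImage
  ObjLGP := LgpDivisor M T.lstar
  frobObjLGP _ := LgpDivisor M T.lstar
  kumLGP _ := Equiv.refl _
  ObjLgp := LgpDivisor M T.lstar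
  frobObjLgp _ := LgpDivisor M T.lstar
  kumLgp _ := Equiv.refl _
  thetaPilot := thetaDiv

omit [NumberField M] in
/-- The Kummer image in `C^⊩_LGP(^{n,∘}HT)` of the built column's Θ-pilot object at `(n,m)` is the lgp-divisor
`thetaDiv m` (Kummer = identity in the strictification). [folklore] -/
theorem ofDivisors_kumLGP_thetaPilot (m : ℤ) :
    (ofDivisors L M frobAdm frobLogvol frobΨ frobMmod unitImage ballImage thetaDiv).kumLGP m
      ((ofDivisors L M frobAdm frobLogvol frobΨ frobMmod unitImage ballImage thetaDiv).thetaPilot m) =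
      thetaDiv m := rfl

end OfDivisors

/-- **VACUITY AUDIT (neutral), for every `L`.** In the STRICTIFIED reading — Frobenius-like binders EQUAL to the
coric data `D` (`frobAdm m := D.Adm`, `frobLogvol m := D.logvol`, `frobΨ m := D.Ψ`, `frobMmod m := D.Mmod`) —
abc-iut-c312-1's typing of [IUTchIII] Thm. 3.11 (ii) for the column is EQUIVALENT TO (Ind3) ALONE: (ii) (a)(b)(c)
hold by reflexivity, the mutual compatibility and the final "[precisely!]" clause follow (c312-1's
`partII_iff`). [folklore] -/
theorem partII_iff_ind3_of_coric (L : LogShells T) (M : Type) [Field M] [NumberField M] (D : MRData L)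
    (unitImage : ℤ → ℕ → ∀ (j : T.Label) (vQ : T.VQ), Set (L.Packet j vQ))
    (ballImage : ℤ → ∀ (j : T.Label) (vQ : T.VQ), Set (L.Packet j vQ)) (thetaDiv : ℤ → LgpDivisor M T.lstar) :
    (ofDivisors L M (fun _ => D.Adm) (fun _ => D.logvol) (fun _ => D.Ψ) (fun _ => D.Mmod) unitImage ballImage
        thetaDiv).PartII D ↔
      (ofDivisors L M (fun _ => D.Adm) (fun _ => D.logvol) (fun _ => D.Ψ) (fun _ => D.Mmod) unitImage ballImage
        thetaDiv).Ind3 D := by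
  rw [Column.partII_iff]
  constructor
  · rintro ⟨-, -, -, h⟩; exact h
  · intro h
    exact ⟨fun _ _ _ _ hA => ⟨hA, rfl⟩, fun _ _ _ => rfl, fun _ _ => rfl, h⟩

end Column

/-! ## 2. The situation of Theorem 3.11 with its columns, from any log-shell signature -/

namespace LatticeSituation

section OfShells

variable (L : LogShells T) (M : Type) [Field M] [NumberField M]
  (archPk : ∀ (j : T.Label) (vQ : T.VQ), Set (L.Packet j vQ))
  (archSub : ∀ (j : T.Label) (v : T.V), Set (L.Packet j (T.over v)))
  (Adm : ∀ (j : T.Label) (vQ : T.VQ), Set (L.Packet j vQ) → Prop)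
  (logvol : ∀ (j : T.Label) (vQ : T.VQ), Set (L.Packet j vQ) → ℝ)
  (Ψ : ℤ → ∀ v : T.V, v ∈ T.Vbad → Set (L.StarPacket v))
  (act : ℤ → ∀ v : T.V, v ∈ T.Vbad → L.StarPacket v → Module.End ℚ (L.StarPacket v))
  (Mmod : ℤ → ∀ j : T.LabelStar, Set (L.GlobalPacket j.1))
  (region : ℤ → ∀ j : T.LabelStar, FinDivisor M → ∀ vQ : T.VQ, Set (L.Packet j.1 vQ))
  (frobAdm : ℤ → ℤ → ∀ (j : T.Label) (vQ : T.VQ), Set (L.Packet j vQ) → Prop)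
  (frobLogvol : ℤ → ℤ → ∀ (j : T.Label) (vQ : T.VQ), Set (L.Packet j vQ) → ℝ)
  (frobΨ : ℤ → ℤ → ∀ v : T.V, v ∈ T.Vbad → Set (L.StarPacket v))
  (frobMmod : ℤ → ℤ → ∀ j : T.LabelStar, Set (L.GlobalPacket j.1))
  (unitImage : ℤ → ℤ → ℕ → ∀ (j : T.Label) (vQ : T.VQ), Set (L.Packet j vQ))
  (ballImage : ℤ → ℤ → ∀ (j : T.Label) (vQ : T.VQ), Set (L.Packet j vQ))
  (thetaDiv : ℤ → ℤ → LgpDivisor M T.lstar)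

/-- **`Thm311.LatticeSituation` BUILT FROM A LOG-SHELL SIGNATURE** ("the situation of Theorem 3.11",
(i)+(ii)-part, [IUTchIII] p. 153: the LGP-Gaussian log-theta-lattice `{^{n,m}HT}_{n,m ∈ ℤ}` of Def. 3.8 (iii) seen
through the vertical coricity of Thm. 1.5 (i)): `Situation.ofShells` together with, for every `n ∈ ℤ`, the
column `Column.ofDivisors` with that column's binders. [claim: Mochizuki2012, status: disputed] -/
def ofShells : LatticeSituation T where
  toSituation := Situation.ofShells L M archPk archSub Adm logvol Ψ act Mmod region
  col n := Column.ofDivisors L M (frobAdm n) (frobLogvol n) (frobΨ n) (frobMmod n) (unitImage n) (ballImage n)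
    (thetaDiv n)

/-- The underlying situation of the built lattice situation is `Situation.ofShells`. [folklore] -/
theorem ofShells_toSituation :
    (ofShells L M archPk archSub Adm logvol Ψ act Mmod region frobAdm frobLogvol frobΨ frobMmod unitImage
        ballImage thetaDiv).toSituation =
      Situation.ofShells L M archPk archSub Adm logvol Ψ act Mmod region := rfl

/-- In the STRICTIFIED reading (each column's Frobenius-like binders := the coric data of its line) Thm. 3.11
(ii) of the built lattice situation (`LatticeSituation.PartII`) is equivalent to its (Ind3) — for every `L`.
[folklore] -/
theorem partII_iff_ind3_of_coric
    (unitImage₀ : ℤ → ℤ → ℕ → ∀ (j : T.Label) (vQ : T.VQ), Set (L.Packet j vQ))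
    (ballImage₀ : ℤ → ℤ → ∀ (j : T.Label) (vQ : T.VQ), Set (L.Packet j vQ))
    (thetaDiv₀ : ℤ → ℤ → LgpDivisor M T.lstar) :
    (ofShells L M archPk archSub Adm logvol Ψ act Mmod region (fun _ _ => Adm) (fun _ _ => logvol)
        (fun n _ => Ψ n) (fun n _ => Mmod n) unitImage₀ ballImage₀ thetaDiv₀).PartII ↔
    (ofShells L M archPk archSub Adm logvol Ψ act Mmod region (fun _ _ => Adm) (fun _ _ => logvol)
        (fun n _ => Ψ n) (fun n _ => Mmod n) unitImage₀ ballImage₀ thetaDiv₀).Ind3 :=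
  forall_congr' fun n =>
    Column.partII_iff_ind3_of_coric L M (MRData.ofShells L archPk archSub Adm logvol (Ψ n) (act n) (Mmod n))
      (unitImage₀ n) (ballImage₀ n) (thetaDiv₀ n)

/-- Under Thm. 3.11 (i) and (ii) for the built lattice situation (HYPOTHESES, never asserted): the Kummer image
of the Frobenius-like splitting monoid of ANY `(n', m)` lies among the possible images `^{n,∘}R^{LGP}` of the
line-`n` data — abc-iut-c312-1's `frobPsi_mem_possibleImages`; the shape in which Cor. 3.12 reads "the union of
the possible images of a Θ-pilot object … relative to the relevant Kummer isomorphisms … in the multiradial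
representation". [claim: Mochizuki2012, status: disputed] -/
theorem frobPsi_mem_possibleImages_ofShells
    (hi : (ofShells L M archPk archSub Adm logvol Ψ act Mmod region frobAdm frobLogvol frobΨ frobMmod unitImage
      ballImage thetaDiv).MultiradialCompat)
    (hii : (ofShells L M archPk archSub Adm logvol Ψ act Mmod region frobAdm frobLogvol frobΨ frobMmod unitImage
      ballImage thetaDiv).PartII)
    (n n' m : ℤ) (v : T.V) (hv : v ∈ T.Vbad) :
    ∃ D' ∈ (ofShells L M archPk archSub Adm logvol Ψ act Mmod region frobAdm frobLogvol frobΨ frobMmod unitImage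
        ballImage thetaDiv).RLGP n,
      frobΨ n' m v hv = D'.Ψ v hv :=
  LatticeSituation.frobPsi_mem_possibleImages _ hi hii n n' m v hv

end OfShells

end LatticeSituation

/-! ## 3. Specialisation to the Dupuy–Hilado-level real carriers: the Θ-pilot divisor of the pilot data -/

namespace Real

variable {F : Type} [Field F] [NumberField F]
variable (X : PilotData F) (logv : PadicLogs F) (Aut Ism : ∀ x : Place F, Set (Carrier x ≃ₗ[ℚ] Carrier x))
  (hAut : ∀ x, LinearEquiv.refl ℚ (Carrier x) ∈ Aut x) (hIsm : ∀ x, LinearEquiv.refl ℚ (Carrier x) ∈ Ism x)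
  (archPk : ∀ (j : (thetaIndex X).Label) (vQ : RatPlace), Set ((logShells X logv Aut Ism hAut hIsm).Packet j vQ))
  (archSub : ∀ (j : (thetaIndex X).Label) (v : Place F),
    Set ((logShells X logv Aut Ism hAut hIsm).Packet j ((thetaIndex X).over v)))
  (Adm : ∀ (j : (thetaIndex X).Label) (vQ : RatPlace), Set ((logShells X logv Aut Ism hAut hIsm).Packet j vQ) → Prop)
  (logvol : ∀ (j : (thetaIndex X).Label) (vQ : RatPlace), Set ((logShells X logv Aut Ism hAut hIsm).Packet j vQ) → ℝ)
  (Ψ : ℤ → ∀ v : Place F, v ∈ (thetaIndex X).Vbad → Set ((logShells X logv Aut Ism hAut hIsm).StarPacket v))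
  (act : ℤ → ∀ v : Place F, v ∈ (thetaIndex X).Vbad → (logShells X logv Aut Ism hAut hIsm).StarPacket v →
    Module.End ℚ ((logShells X logv Aut Ism hAut hIsm).StarPacket v))
  (Mmod : ℤ → ∀ j : (thetaIndex X).LabelStar, Set ((logShells X logv Aut Ism hAut hIsm).GlobalPacket j.1))
  (region : ℤ → ∀ j : (thetaIndex X).LabelStar,
    FinDivisor F → ∀ vQ : RatPlace, Set ((logShells X logv Aut Ism hAut hIsm).Packet j.1 vQ))
  (frobAdm : ℤ → ℤ → ∀ (j : (thetaIndex X).Label) (vQ : RatPlace),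
    Set ((logShells X logv Aut Ism hAut hIsm).Packet j vQ) → Prop)
  (frobLogvol : ℤ → ℤ → ∀ (j : (thetaIndex X).Label) (vQ : RatPlace),
    Set ((logShells X logv Aut Ism hAut hIsm).Packet j vQ) → ℝ)
  (frobΨ : ℤ → ℤ → ∀ v : Place F, v ∈ (thetaIndex X).Vbad → Set ((logShells X logv Aut Ism hAut hIsm).StarPacket v))
  (frobMmod : ℤ → ℤ → ∀ j : (thetaIndex X).LabelStar, Set ((logShells X logv Aut Ism hAut hIsm).GlobalPacket j.1))
  (unitImage : ℤ → ℤ → ℕ → ∀ (j : (thetaIndex X).Label) (vQ : RatPlace),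
    Set ((logShells X logv Aut Ism hAut hIsm).Packet j vQ))
  (ballImage : ℤ → ℤ → ∀ (j : (thetaIndex X).Label) (vQ : RatPlace),
    Set ((logShells X logv Aut Ism hAut hIsm).Packet j vQ))

/-- **"The situation of Theorem 3.11" ((i)+(ii)-part) over the REAL carriers of `Thm311Real`**, the Θ-pilot
object of every `^{n,m}C^⊩_LGP` being abc-iut-c312-3's Θ-pilot divisor `X.thetaPilot = (j²·P_q)_{j=1..l⋇}` of the
pilot data (Dupuy–Hilado §3.3) — no binder for it at this level. [claim: Mochizuki2012, status: disputed] -/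
abbrev latticeSituation : LatticeSituation (thetaIndex X) :=
  LatticeSituation.ofShells (logShells X logv Aut Ism hAut hIsm) F archPk archSub Adm logvol Ψ act Mmod region
    frobAdm frobLogvol frobΨ frobMmod unitImage ballImage (fun _ _ => X.thetaPilot)

/-- The Kummer image in `C^⊩_LGP(^{n,∘}HT)` of the real instance's Θ-pilot object at `(n,m)` IS Dupuy–Hilado's
Θ-pilot divisor `P_Θ = (j²·P_q)_j`. [cite: DupuyHilado2025, §3.3] -/
theorem kumLGP_thetaPilot (n m : ℤ) :
    ((latticeSituation X logv Aut Ism hAut hIsm archPk archSub Adm logvol Ψ act Mmod region frobAdm frobLogvol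
        frobΨ frobMmod unitImage ballImage).col n).kumLGP m
      (((latticeSituation X logv Aut Ism hAut hIsm archPk archSub Adm logvol Ψ act Mmod region frobAdm frobLogvol
        frobΨ frobMmod unitImage ballImage).col n).thetaPilot m) = X.thetaPilot := rfl

/-- Its lgp-degree EXCEEDS `deg P_q` (abc-iut-c312-3's `deg_qPilot_lt_degLgp_thetaPilot`, DH §3.3): the arithmetic
behind "`C_Θ ≥ −1`" being non-trivial only because `P_Θ ≠ P_q`. [cite: DupuyHilado2025, §3.3] -/
theorem deg_qPilot_lt_degLgp_thetaPilot (n m : ℤ) :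
    FinDivisor.deg F X.qPilot <
      LgpDivisor.degLgp (((latticeSituation X logv Aut Ism hAut hIsm archPk archSub Adm logvol Ψ act Mmod region
        frobAdm frobLogvol frobΨ frobMmod unitImage ballImage).col n).kumLGP m
        (((latticeSituation X logv Aut Ism hAut hIsm archPk archSub Adm logvol Ψ act Mmod region frobAdm
          frobLogvol frobΨ frobMmod unitImage ballImage).col n).thetaPilot m)) :=
  X.deg_qPilot_lt_degLgp_thetaPilot

end Real

end Summit.ABC.IUTFork.Thm311

end
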